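import Literature.IUT.HodgeTheaters.GaloisValDatumInvariantsFunctor
import Literature.IUT.HodgeArakelov.GMonoidFrobenioidsPerfection
import Literature.AlgebraicGeometry.Frobenioids.PadicFrobenioidConstantMonoid
import HarnessLib

/-!
# [IUTchII] Def. 3.8 (i) «whose divisor monoid associates to EVERY object of `B^temp(Π_X(M^Θ_*))⁰` a monoid isomorphic to
# `ℚ_{≥0}`» — PROVED at the GENUINE constant monoid `𝒪^▷_{K̄_v}` (proof-only corollary; junction L5 × L6 × L1)

S. Mochizuki, *Inter-universal Teichmüller theory II*, §3, kurims manuscript (Dec. 2020), Definition 3.8 (i) p. 113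
l. 2–13 «… gives rise to a `p_v`-adic Frobenioid of monoid type `ℤ` [cf. [FrdII], Example 1.1, (ii)] `F_cns(M^Θ_*)`;
`F_{†C_v}` whose divisor monoid associates to every object of `B^temp(Π_X(M^Θ_*))⁰` a monoid isomorphic to `ℚ_{≥0}`»
[cite: Mochizuki2012, Def 3.8 (i) p.113] (pages = kurims render IUTchII-kurims-url-5036b4059555; D-0012 claim key,
status disputed — nothing of the series is asserted); [FrdII] Ex. 1.1 (i) p. 7 l. 17–24 «`ord(𝒪^▷_K) := 𝒪^▷_K/𝒪^×_K ⊆ ord(K^×)`»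
(≅ `ℤ_{≥0}` for a `p`-adic local field — our gloss, not printed there) [cite: MochizukiFrdII2008, Ex 1.1 (i) p.7]; [FrdI] §0 p. 11
l. 21–30 (the perfection `M^pf` of a monoid; that `(ℤ_{≥0})^pf ≅ ℚ_{≥0}` is our gloss).

abc-iut cell, seat abc-iut-L6-t7 (gen 4, MERGE-MAP writer); the genuine-producer corollary announced in the headers of
`GMonoidFrobenioidsPerfection.lean` (p460547, row X-L6t7-GMFP) and `GaloisValDatumInvariantsFunctor.lean` (p459689,
B16-ii).  PROOF-ONLY (0 defs, 0 instances, no `Prop` fact, no sorry), everything consumed BY NAME: abc-iut-L5-t2's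
`GaloisValDatum.coveringMonoid` (p456702) and `fieldFunctor_isPadicLocal`, this seat's `divisorFunctorObjEquiv`
(p459689) and `CoveringMonoid.isQMonoprime_divisorFunctorPf_obj` (p460547), abc-iut-w4-d019's
`CoveringMonoid.divisorFunctor` (p455796), abc-iut-L1's `PadicFld.IsPadicLocal.isZMonoprime_ordInt` /
`IsZMonoprime` / `IsQMonoprime` / `IsMonoprime`.

WHAT IS PROVED (for every `d : GaloisValDatum p` — `K_v` a `p`-adic local field, `Ω = K̄_v`, `G_v = Gal(Ω/K_v)` — and
EVERY object `G_v/U` of `D⊢_v = CosetCat d.Gal`):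
* `isZMonoprime_divisorFunctor_obj` — the divisor monoid `Φ(G_v/U) = (𝒪^▷_{K̄_v})^U/((𝒪^▷_{K̄_v})^U)^× ≅ ord(𝒪^▷_{Ω^U})`
  of abc-iut-w4-d019's model Frobenioid of the genuine `G_v`-monoid is `≅ ℤ_{≥0}` («monoid type `ℤ`»; [FrdII] Ex 1.1
  (ii)'s «monoprime subfunctor» condition objectwise: `isMonoprime_divisorFunctor_obj`);
* **`isQMonoprime_divisorFunctorPf_obj`** — its perfection `Φ^pf(G_v/U)` is `≅ ℚ_{≥0}` at EVERY object: the printed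
  clause of Def 3.8 (i) for `F_cns`, at the genuine constant monoid (R-Def38-a (i), genuine producer).
HONEST FRAMING: OUR kernel check of a valuation-theoretic fact about `K̄_v/K_v` over the tree's typed interfaces;
the identification `Ψ_cns(M^Θ_*) ≅ 𝒪^▷_{F̄_v}` (Prop 3.1 (ii)) that routes print's `F_cns(M^Θ_*)` to this genuine monoid is
the NODES row IUTchII:Prop3.1(ii) (its own status), not asserted here; no side taken on [IUTchIII] Cor. 3.12;
typed ≠ proved for anything of [IUTchI–III].
-/

namespace Literature.IUT.HodgeTheaters

open CategoryTheory Opposite Literature.AnabelianGeometry.SemiGraphs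
  Literature.AlgebraicGeometry.Frobenioids Literature.AlgebraicGeometry.Frobenioids.PadicFrd
  Literature.IUT.HodgeArakelov

universe u

namespace GaloisValDatum

variable {p : ℕ} [Fact p.Prime] (d : GaloisValDatum.{u} p)

/-- **`Φ(G_v/U) ≅ ℤ_{≥0}` at every object**: the divisor monoid at `G_v/U` of the model Frobenioid of the genuine
`G_v`-monoid `𝒪^▷_{K̄_v}` is `ord(𝒪^▷_{Ω^U})` (`divisorFunctorObjEquiv`, p459689), and `Ω^U` is a `p`-adic local field
(`fieldFunctor_isPadicLocal`), whose `ord(𝒪^▷)` is `≅ ℤ_{≥0}` (abc-iut-L1's `IsPadicLocal.isZMonoprime_ordInt`).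
[cite: MochizukiFrdII2008, Ex 1.1 (i) p.7] -/
theorem isZMonoprime_divisorFunctor_obj (X : (CosetCat d.Gal)ᵒᵖ) :
    IsZMonoprime (d.coveringMonoid.divisorFunctor.obj X) := by
  obtain ⟨⟨e⟩⟩ := (d.fieldFunctor_isPadicLocal (unop X)).isZMonoprime_ordInt
  exact ⟨⟨(d.divisorFunctorObjEquiv X).trans e⟩⟩

/-- Hence `Φ(G_v/U)` is monoprime at every object ([FrdII] Ex 1.1 (ii) «monoprime subfunctor in monoids», objectwise,
for the divisor monoid read off the genuine `G_v`-monoid). [cite: MochizukiFrdII2008, Ex 1.1 (ii) p.8] -/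
theorem isMonoprime_divisorFunctor_obj (X : (CosetCat d.Gal)ᵒᵖ) :
    IsMonoprime (d.coveringMonoid.divisorFunctor.obj X) :=
  IsMonoprime.ofZ (d.isZMonoprime_divisorFunctor_obj X)

/-- **[IUTchII] Def 3.8 (i) «… associates to every object … a monoid isomorphic to `ℚ_{≥0}`», at the genuine constant
monoid**: for EVERY object `G_v/U` of `D⊢_v`, the perfected divisor monoid `Φ^pf(G_v/U)` of the model Frobenioid of the
`G_v`-monoid `𝒪^▷_{K̄_v}` (this seat's `CoveringMonoid.divisorFunctorPf`, p460547) is `≅ ℚ_{≥0}`.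
[cite: Mochizuki2012, Def 3.8 (i) p.113] -/
theorem isQMonoprime_divisorFunctorPf_obj (X : (CosetCat d.Gal)ᵒᵖ) :
    IsQMonoprime (d.coveringMonoid.divisorFunctorPf.obj X) :=
  d.coveringMonoid.isQMonoprime_divisorFunctorPf_obj X (d.isZMonoprime_divisorFunctor_obj X)

/-- The same clause packaged over the whole base: the perfected divisor monoid of the genuine `G_v`-monoid is
OBJECTWISE `ℚ`-monoprime (abc-iut-L1's `Objectwise` predicate of [FrdI] Def 1.1 (ii) «if every monoid `Φ(A)` satisfies
some property …»). [cite: Mochizuki2012, Def 3.8 (i) p.113] -/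
theorem objectwise_isQMonoprime_divisorFunctorPf :
    Objectwise (fun X _ => IsQMonoprime X) d.coveringMonoid.divisorFunctorPf :=
  fun X => d.isQMonoprime_divisorFunctorPf_obj (op X)

end GaloisValDatum

end Literature.IUT.HodgeTheaters
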